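import Literature.Computability.QuantumComplexity.RevUncomputeUniform
import HarnessLib

/-!
# Printing clean blocks at an offset: parametric printers whose gate alphabet depends on the family index

Sequel of `RevUncomputeUniform.lean` (the parametric generators `RevClean.inputGW`,
`RevClean.stepGW`, `RevClean.compGW`, `RevClean.outGW` printing the tableau and the read-out
of a clean reversible block through an arbitrary printer `og` of gate lists, under the
hypothesis `hog : (og ops).out env = (ops.map (ClOp.map (GExpr.eval env))).flatMap φ` with a
*fixed* token map `φ`). A construction placing a clean block at an *offset* depending on the
family index `n` (a block shifted by `R(n)` wires inside a larger register,
`(cleanOps e M n v).map (ClOp.map (· + R n))` — as in the planned time-multiplexed classical-wrap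
family, the sequel of `ClassicalWrapGadgets.lean`/`ClassicalWrapReadout.lean` in preparation; the
classical wrap `CWrapProg.lean` already in the tree keeps its blocks unshifted instead)
prints it through the **shifting printer** `ogShift S ops = opsG (ops.map (ClOp.map (· + S)))`
for an expression `S` in the family-index variable `uu`; its token map `op ↦ opToks (op + S(env))`
depends on `env .uu`. This file re-proves the four printing identities for token maps
`φ : ℕ → ClOp ℕ → List Tok` depending on `env .uu` (which no generator loop modifies):

* `out_inputGW'`, `out_stepGW'`, `out_compGW'`, `out_outGW'` (same proofs, tracking `uu`;
  they supersede the unprimed identities of `RevUncomputeUniform.lean`: take `φ := fun _ => φ₀`);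
* `ogShift`, `out_ogShift`, `loopVars_ogShift_sub`, `noReuse_ogShift`;
* **`out_compGW_shift`**, **`reverse_out_compGWR_shift`**, **`out_outGW_shift`**: the generators
  print `(comp …).map (· + S(n))` (forwards, and backwards for the uncomputation) and
  `(outOps …).map (· + S(n))`, the pieces of the shifted clean block.

## References

* S. Arora, B. Barak, *Computational Complexity: A Modern Approach*, CUP 2009, §6.2 and proof
  of Thm. 6.15 (descriptions printed with counters), Remark 6.7.
* C. H. Bennett, *Logical reversibility of computation*, IBM J. Res. Develop. 17 (1973), §2
  (not held; restated in Nielsen–Chuang 2010, §3.2.5).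
-/

noncomputable section

namespace Literature.Computability.QuantumComplexity

open _root_.Computability Complexity Turing RevDesc RevSim

namespace RevClean

/-! ### The parametric identities with a `uu`-dependent token map -/

section Parametric

variable {tm : FinTM2} {e : ℕ}

/-- **The parametric step generator prints the step** through a printer whose token map may
depend on the family index `env .uu` (supersedes `out_stepGW`: take a constant `φ`; the proof is
the same, tracking `uu`). [folklore] -/
theorem out_stepGW' (φ : ℕ → ClOp ℕ → List Tok) (og : List (ClOp GE) → GS)
    (hog : ∀ ops env, (og ops).out env = (ops.map (ClOp.map (GExpr.eval env))).flatMap (φ (env .uu)))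
    (env : GV → ℕ) :
    (stepGW tm e og).out env = (stepOps tm e (env .xn) (env .tt)).flatMap (φ (env .uu)) := by
  have hxj : ∀ j, Function.update env GV.jj j GV.xn = env .xn := fun j => by simp
  have htj : ∀ j, Function.update env GV.jj j GV.tt = env .tt := fun j => by simp
  have huj : ∀ j, Function.update env GV.jj j GV.uu = env .uu := fun j => by simp
  simp only [stepGW, GStmt.out, out_seqs, List.flatMap_map, hog, chainOpsE_eval, ctrlOpsE_eval,
    cellOpLowE_eval, cellOpHighE_eval, phantomE_eval, GExpr.eval, hxj, htj, huj, Function.update_self,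
    eval_TnE, eval_SnE, stepOps, restOps, cellOps, List.flatMap_append, List.flatMap_assoc]
  rw [Sn_eq, flatMap_range_add (2 * dd tm), flatMap_range']
  simp only [List.append_assoc]

variable {M : TM2ComputableAux Bool Bool}

/-- **The parametric input generator prints the input layer** (`uu`-dependent token map). [folklore] -/
theorem out_inputGW' (φ : ℕ → ClOp ℕ → List Tok) (og : List (ClOp GE) → GS)
    (hog : ∀ ops env, (og ops).out env = (ops.map (ClOp.map (GExpr.eval env))).flatMap (φ (env .uu)))
    (env : GV → ℕ) :
    (inputGW e M og).out env = (inputOps e M (env .xn)).flatMap (φ (env .uu)) := by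
  have hxj : ∀ j, Function.update env GV.jj j GV.xn = env .xn := fun j => by simp
  have huj : ∀ j, Function.update env GV.jj j GV.uu = env .uu := fun j => by simp
  simp only [inputGW, GStmt.out, hog, inCellE_eval, emptyCellE_eval, GExpr.eval, hxj, huj,
    Function.update_self, eval_TnE, inputOps, List.flatMap_append, List.map_cons, List.map_nil, ClOp.map,
    eval_ctrlWE, List.flatMap_assoc]
  rw [flatMap_range', Sn_add_sub]

/-- **The compute generator prints the compute half** (`uu`-dependent token map). [folklore] -/
theorem out_compGW' (φ : ℕ → ClOp ℕ → List Tok) {og : List (ClOp GE) → GS}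
    (hog : ∀ ops env, (og ops).out env = (ops.map (ClOp.map (GExpr.eval env))).flatMap (φ (env .uu)))
    (hlv : ∀ ops, ∀ x ∈ (og ops).loopVars, x = GV.ii) {NE : GE} (hNE : InUU NE) (env : GV → ℕ) :
    (compGW e M og NE).out env = (comp e M (NE.eval env)).flatMap (φ (env .uu)) := by
  rw [compGW, GStmt.out_subst _ _ (substOK_substN hNE (loopVars_comp_sub hlv)), eval_substN]
  have hxt : ∀ t, Function.update (Function.update env GV.xn (NE.eval env)) GV.tt t GV.xn = NE.eval env :=
    fun t => by simp
  have hut : ∀ t, Function.update (Function.update env GV.xn (NE.eval env)) GV.tt t GV.uu = env .uu :=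
    fun t => by simp
  have hux : Function.update env GV.xn (NE.eval env) GV.uu = env .uu := by simp
  simp only [GStmt.out, out_inputGW' φ og hog, out_stepGW' φ og hog, Function.update_self, eval_TnE, hxt, hut, hux,
    comp, List.flatMap_append, List.flatMap_assoc]

/-- **The read-out generator prints the read-out** (`uu`-dependent token map). [folklore] -/
theorem out_outGW' (φ : ℕ → ClOp ℕ → List Tok) {og : List (ClOp GE) → GS}
    (hog : ∀ ops env, (og ops).out env = (ops.map (ClOp.map (GExpr.eval env))).flatMap (φ (env .uu)))
    (hlv : ∀ ops, ∀ x ∈ (og ops).loopVars, x = GV.ii) {NE : GE} (hNE : InUU NE) (env : GV → ℕ) :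
    (outGW e M og NE).out env = (outOps e M (NE.eval env)).flatMap (φ (env .uu)) := by
  have hok : GStmt.SubstOK (substN NE) (GStmt.loop .jj (JJE e M) (seqs ((aList M).map fun a =>
      og [ClOp.cnot (cellWE M.tm e (TnE e) (.var .jj) ⟨M.tm.k₁, a⟩) (resWE e M (.var .jj) a)]))) := by
    refine substOK_substN hNE fun i hi => ?_
    simp only [GStmt.loopVars, List.mem_cons, loopVars_seqs, List.mem_flatMap, List.mem_map] at hi
    rcases hi with rfl | ⟨s, ⟨a, -, rfl⟩, hx⟩
    · exact Or.inr (Or.inl rfl)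
    · exact Or.inr (Or.inr (hlv _ i hx))
  rw [outGW, GStmt.out_subst _ _ hok, eval_substN]
  have hxj : ∀ j, Function.update (Function.update env GV.xn (NE.eval env)) GV.jj j GV.xn = NE.eval env :=
    fun j => by simp
  have huj : ∀ j, Function.update (Function.update env GV.xn (NE.eval env)) GV.jj j GV.uu = env .uu :=
    fun j => by simp
  simp only [GStmt.out, out_seqs, List.flatMap_map, hog, Function.update_self, eval_JJE, hxj, huj, outOps,
    copyOps, outPairs, List.map_flatMap, List.map_map, List.flatMap_assoc, List.map_cons, List.map_nil,
    ClOp.map, eval_cellWE, eval_TnE, eval_resWE, GExpr.eval, List.flatMap_cons, List.flatMap_nil,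
    List.append_nil, Function.comp_apply, List.flatMap_map]

end Parametric

/-! ### The shifting printer -/

/-- **The shifting printer**: print every gate with all its wires shifted by the expression `S`.
[folklore] -/
def ogShift (S : GE) (ops : List (ClOp GE)) : GS := opsG (ops.map (ClOp.map fun w => GExpr.add w S))

/-- The token map of the shifting printer: the word of the shifted gate. [folklore] -/
def shiftToks (s : ℕ) (op : ClOp ℕ) : List Tok := opToks (op.map (· + s))

/-- **The shifting printer prints the shifted gates**, with a token map depending on `env`
only through the value of `S`. [folklore] -/
theorem out_ogShift (S : GE) (ops : List (ClOp GE)) (env : GV → ℕ) :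
    (ogShift S ops).out env = (ops.map (ClOp.map (GExpr.eval env))).flatMap (shiftToks (S.eval env)) := by
  simp only [ogShift, out_opsG, List.map_map, List.flatMap_map]
  refine congrArg List.flatten (List.map_congr_left fun op _ => ?_)
  cases op <;> rfl

/-- An expression in `uu` only has the same value in every environment with the same `uu`.
[folklore] -/
theorem eval_eq_of_inUU {T : GE} (hT : InUU T) (env : GV → ℕ) : T.eval env = T.eval fun _ => env .uu := by
  induction T with
  | const c => rfl
  | var x =>
    have hx : x = .uu := hT x (by simp [GExpr.fv])
    subst hx; rfl
  | add a b iha ihb =>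
    have ha : InUU a := fun x hx => hT x (by simp [GExpr.fv, hx])
    have hb : InUU b := fun x hx => hT x (by simp [GExpr.fv, hx])
    simp only [GExpr.eval, iha ha, ihb hb]
  | mul a b iha ihb =>
    have ha : InUU a := fun x hx => hT x (by simp [GExpr.fv, hx])
    have hb : InUU b := fun x hx => hT x (by simp [GExpr.fv, hx])
    simp only [GExpr.eval, iha ha, ihb hb]

/-- For `S` in `uu` only, the token map of the shifting printer depends on `env .uu` only.
[folklore] -/
theorem out_ogShift_of_inUU {S : GE} (hS : InUU S) (ops : List (ClOp GE)) (env : GV → ℕ) :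
    (ogShift S ops).out env =
      (ops.map (ClOp.map (GExpr.eval env))).flatMap (shiftToks (S.eval fun _ => env .uu)) := by
  rw [out_ogShift, eval_eq_of_inUU hS env]

/-- Loop variables of the shifting printer (those of `opsG`: the tick counter). [folklore] -/
theorem loopVars_ogShift_sub (S : GE) (ops : List (ClOp GE)) : ∀ x ∈ (ogShift S ops).loopVars, x = GV.ii :=
  loopVars_opsG_sub _

/-- Non-reuse of the shifting printer. [folklore] -/
theorem noReuse_ogShift (S : GE) (ops : List (ClOp GE)) : (ogShift S ops).noReuse = true := noReuse_opsG _

/-- The shifted token stream is the stream of the shifted program. [folklore] -/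
theorem flatMap_shiftToks (s : ℕ) (ops : List (ClOp ℕ)) :
    ops.flatMap (shiftToks s) = (ops.map (ClOp.map (· + s))).flatMap opToks := by
  rw [List.flatMap_map]
  rfl

/-! ### The shifted clean block, printed -/

section Shifted

variable {e : ℕ} {M : TM2ComputableAux Bool Bool} {S NE : GE} (hS : InUU S) (hNE : InUU NE)
include hS

/-- The value of `S` along the run (it reads `uu` only). [folklore] -/
theorem eval_inUU_eq (env : GV → ℕ) : S.eval (fun _ => env .uu) = S.eval env := (eval_eq_of_inUU hS env).symm

include hNE

/-- **The forward compute generator through the shifting printer prints the shifted compute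
half.** [folklore] -/
theorem out_compGW_shift (env : GV → ℕ) :
    (compGW e M (ogShift S) NE).out env =
      ((comp e M (NE.eval env)).map (ClOp.map (· + S.eval env))).flatMap opToks := by
  rw [out_compGW' (fun u => shiftToks (S.eval fun _ => u)) (fun ops env' => out_ogShift_of_inUU hS ops env')
    (loopVars_ogShift_sub S) hNE env, eval_inUU_eq hS, flatMap_shiftToks]

/-- **The read-out generator through the shifting printer prints the shifted read-out.** [folklore] -/
theorem out_outGW_shift (env : GV → ℕ) :
    (outGW e M (ogShift S) NE).out env =
      ((outOps e M (NE.eval env)).map (ClOp.map (· + S.eval env))).flatMap opToks := by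
  rw [out_outGW' (fun u => shiftToks (S.eval fun _ => u)) (fun ops env' => out_ogShift_of_inUU hS ops env')
    (loopVars_ogShift_sub S) hNE env, eval_inUU_eq hS, flatMap_shiftToks]

end Shifted

/-! ### The shifting printer, backwards (for the uncomputation) -/

/-- **The backward shifting printer**: the tokens of every shifted gate word back to front
(`opsGR` of `RevUncomputeUniform.lean` on the shifted gates). [folklore] -/
def ogShiftR (S : GE) (ops : List (ClOp GE)) : GS := opsGR (ops.map (ClOp.map fun w => GExpr.add w S))

/-- The backward shifting printer prints the reversed words of the shifted gates. [folklore] -/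
theorem out_ogShiftR (S : GE) (ops : List (ClOp GE)) (env : GV → ℕ) :
    (ogShiftR S ops).out env =
      (ops.map (ClOp.map (GExpr.eval env))).flatMap fun op => (shiftToks (S.eval env) op).reverse := by
  have h1 : (ogShiftR S ops).out env = ((ops.map (ClOp.map fun w => GExpr.add w S)).map (ClOp.map (GExpr.eval env))).flatMap
      fun op => (opToks op).reverse := out_opsGR _ env
  rw [h1, List.map_map, List.flatMap_map, List.flatMap_map]
  refine congrArg List.flatten (List.map_congr_left fun op _ => ?_)
  cases op <;> rfl

/-- For `S` in `uu` only, the token map of the backward shifting printer depends on `env .uu`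
only. [folklore] -/
theorem out_ogShiftR_of_inUU {S : GE} (hS : InUU S) (ops : List (ClOp GE)) (env : GV → ℕ) :
    (ogShiftR S ops).out env =
      (ops.map (ClOp.map (GExpr.eval env))).flatMap fun op => (shiftToks (S.eval fun _ => env .uu) op).reverse := by
  rw [out_ogShiftR, eval_eq_of_inUU hS env]

/-- Loop variables of the backward shifting printer. [folklore] -/
theorem loopVars_ogShiftR_sub (S : GE) (ops : List (ClOp GE)) : ∀ x ∈ (ogShiftR S ops).loopVars, x = GV.ii :=
  loopVars_opsGR_sub _

/-- Non-reuse of the backward shifting printer. [folklore] -/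
theorem noReuse_ogShiftR (S : GE) (ops : List (ClOp GE)) : (ogShiftR S ops).noReuse = true := noReuse_opsGR _

/-- **The backward compute generator through the shifting printer**: the reversal of its stream is
the stream of the reversed shifted compute half (the uncomputation of the shifted block).
[folklore] -/
theorem reverse_out_compGWR_shift {e : ℕ} {M : TM2ComputableAux Bool Bool} {S NE : GE} (hS : InUU S) (hNE : InUU NE)
    (env : GV → ℕ) :
    ((compGW e M (ogShiftR S) NE).out env).reverse =
      ((comp e M (NE.eval env)).map (ClOp.map (· + S.eval env))).reverse.flatMap opToks := by
  rw [out_compGW' (fun u op => (shiftToks (S.eval fun _ => u) op).reverse) (fun ops env' => out_ogShiftR_of_inUU hS ops env')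
    (loopVars_ogShiftR_sub S) hNE env, eval_inUU_eq hS, List.reverse_flatMap, ← List.map_reverse, List.flatMap_map]
  simp only [Function.comp_def, List.reverse_reverse, shiftToks]

end RevClean

end Literature.Computability.QuantumComplexity
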